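import Summits.BirchSwinnertonDyer.BirchSwinnertonDyer.Theorems.KatoDescentPotSupersingularKatoSelmerPTCokernelTorsion
import Summits.BirchSwinnertonDyer.BirchSwinnertonDyer.Theorems.KatoDescentPotSupersingularKatoSelmerSSide
import Summits.BirchSwinnertonDyer.BirchSwinnertonDyer.Theorems.KatoDescentPotSupersingularASideLedger
import HarnessLib

/-!
# The SHARP A⊕S ledger of crux M at the zeta line (one torsion power): for `k ≫ 0`,
# `#Sel_{p^∞}(E/ℚ) · ∏_{ℓ∈T∖{p}} #H¹_ur(ℚ_ℓ,E[p^∞]) · [B_k(ℤ_p y₀) : B_k(ℤ_p y₀) ⊓ 𝓚_k^⊥] · [A : ℤ_p y₀] ≤ #Sel_str^{ur}(E[p^∞]) · p^k · [E(ℚ):p^kE(ℚ)]`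
# — part 49 WITHOUT its factor `#E(ℚ)[p^N]`: the torsion factor of the A-side junction cancels against the `#A_tors` of the sharp companion (ii)
# (route `KatoDescentPotSupersingular` / `…Tame…`, crux M = stmt-BirchSwinnertonDyer-19196, U₀-red 19190/19203; route-free helper)

Seat `bsd-potss-rkm` g24 (prover; cell `bsd-potss`), TARGET R283 / wake W-M6 (`--supports …`; closes nothing).  HONEST FRAMING: BSD is not
proved by any of this; nothing is booked; theorems only (no definition, no named fact).

## What (Kato, Astérisque 295, proof of Prop. 14.16, p. 244: `H¹_f(ℤ[1/p],T) = H¹(ℤ[1/p],T)_tors` and Cassels' cokernel count)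

Part 49 (`exists_forall_aSide_le`) multiplies the S-side (part 46 = brick (a) × companion (ii)) by the A-side junction (part 47,
`[f(Y) : f(Y) ∩ K']·[A : Y] ≤ [f(A) : f(A) ∩ K']·#(A ⊓ H¹(ℚ,T_pE)[p^N])`) and then bounds the junction's torsion factor by `#E(ℚ)[p^N]` (part 48).  With
the SHARP companion (ii) (`…KatoSelmerPTCokernelTorsion.natCard_selmerGroupPInfty_mul_prod_unramified_mul_torsion_le_index`, which carries the SAME
factor `#(A ⊓ H¹(ℚ,T_pE)[p^N])` on its left) the two torsion factors CANCEL, and the ledger loses one power of `#W(ℚ)_tors`: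

* `exists_forall_natCard_selmerGroupPInfty_mul_prod_unramified_mul_torsion_le` — the sharp (ii), TURNKEY (`∃ s K₀, ∀ k ≥ K₀`, every Weil datum /
  Poitou–Tate family at level `p^s p^k`): part 44c with `s ≥` the exponent of `Ш[p^∞]` AND g17's bound `e₁` of (hN) (`exists_forall_hN`, uniform in
  `k`), `K₀ ≥ #W(ℚ)_tors` (so `#W(ℚ)_tors < p^k`) and `p^k` killing the `H¹_ur(ℚ_ℓ,E[p^∞])`;
* `exists_forall_sSide_sharp_le` — brick (a) (part 37) × the sharp (ii):
  `#Sel_{p^∞} · ∏#H¹_ur · #(A ⊓ H¹(ℚ,T_pE)[p^N]) · [B_k(A) : B_k(A) ⊓ 𝓚_k^⊥] ≤ #Sel_str^{ur} · p^k · [E(ℚ):p^kE(ℚ)]`;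
* **`exists_forall_aSide_sharp_le`** — × the junction (part 47): the displayed ledger, hypotheses exactly as part 49 with `W(ℚ)` finite
  (rank `0`) in place of `Sel_{p^∞}` finite.  Downstream (parts 50/52/54/58 re-run, next file) this is Kato's count with `2·ord_p #W(ℚ)_tors` in place
  of `3·ord_p #W(ℚ)_tors`, i.e. the `count` of the SHARP member package (`MemberCountInputs.sha_add_tamagawa_le`'s `2t`).

References: K. Kato, Astérisque 295 (2004), §14.8 (p. 238), (14.9.3) (p. 240), Prop. 14.16 and its proof (pp. 244–245), Lemma 14.18 (pp. 247–248)
[Kato2004Asterisque]; R. Greenberg, LNM 1716 (1999), §3 Lemma 3.3, appendix to §4 [GreenbergLNM1716]; J. S. Milne, *ADT* I Cor. 2.3, Thm. 2.6, Lemma 3.3,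
Thm. 4.10 (b) [MilneADT2006].
-/

-- the summit and its single problem are both named `BirchSwinnertonDyer` (registry layout D-0017)
set_option linter.dupNamespace false
set_option autoImplicit false

noncomputable section

open scoped Classical ContRepresentation NumberField AddSubgroup
open CategoryTheory Function Field NumberField IsDedekindDomain WeierstrassCurve
open Literature.NumberTheory.EllipticCurves Literature.NumberTheory.GaloisRepresentations
  Literature.NumberTheory.GaloisRepresentations.DiscreteGaloisModule Literature.NumberTheory.GaloisCohomology
open Literature.NumberTheory.EllipticCurves.Kato2004 Literature.NumberTheory.EllipticCurves.Kato2004.EulerSystemValues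
open Summit.BirchSwinnertonDyer.Rank1Residual.X11b.Levels Summit.BirchSwinnertonDyer.Rank1Residual.X11b.LocBridge
  Summit.BirchSwinnertonDyer.Rank1Residual.X11b.LevelKummer Summit.BirchSwinnertonDyer.Rank1Residual.X11b.FiniteDuality
  Summit.BirchSwinnertonDyer.Rank1Residual.X11b.AcSelmer
open Summit.BirchSwinnertonDyer.Rank1Residual.GaloisImage
open Summit.BirchSwinnertonDyer.BirchSwinnertonDyer.Theorems.KummerTowerOrthogonal
open Summit.BirchSwinnertonDyer.BirchSwinnertonDyer.Theorems.ASideJunction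
open Summit.BirchSwinnertonDyer.BirchSwinnertonDyer.Theorems.H1TateTorsion

namespace Summit.BirchSwinnertonDyer.BirchSwinnertonDyer.Theorems.KatoFiniteLevelCount

/-! ## §1 The sharp companion (ii), turnkey -/

section Turnkey

variable (W : WeierstrassCurve ℚ) [W.IsElliptic] (p : ℕ) [Fact p.Prime] [ContinuousSMul ℤ_[p] (W.tateModule p)]
  (T : Finset (HeightOneSpectrum (𝓞 ℚ)))

/-- **THE SHARP COKERNEL BOUND (ii), TURNKEY: `∃ s K₀, ∀ k ≥ K₀:
#Sel_{p^∞}(E/ℚ) · ∏_{ℓ ∈ T∖{p}} #H¹_ur(ℚ_ℓ, E[p^∞]) · #(A ⊓ H¹(ℚ,T_pE)[p^N]) ≤ #S · [E(ℚ) : p^k E(ℚ)]`** for every level-`p^s p^k` Weil datum (alternating,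
non-degenerate) and every family of local invariants at level `p^s p^k` with `IsPerfect` and `SelmerComplement` — `p` odd, `T ∋ v_p` off which `W` is good,
`W(ℚ)` finite (rank `0`), `Ш(E/ℚ)[p^∞]` finite, `S` Kato's `H¹_{𝓤∞} ⊓ selmerLocalKerPrimary W ℚ_p p`, `A = H¹(ℤ[1/p], T_pE)`.  `s` exceeds the exponent
of `Ш[p^∞]` and g17's (hN)-bound `e₁`; `K₀` exceeds `#W(ℚ)_tors` and the exponents of the `H¹(ℚ_ℓ, E[p^∞])`, `ℓ ∈ T∖p`.
[cite: Kato2004Asterisque, §14.8 (p. 238) and proof of Prop. 14.16 (pp. 244–245)] [cite: GreenbergLNM1716, §3 Lemma 3.3 and appendix to §4]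
[cite: MilneADT2006, Ch. I, Thm. 2.6, Thm. 4.10 (b)] -/
theorem exists_forall_natCard_selmerGroupPInfty_mul_prod_unramified_mul_torsion_le (hodd : p ≠ 2)
    (hpT : primePlace p ∈ T) (hT : ∀ v : HeightOneSpectrum (𝓞 ℚ), v ∉ T → W.HasGoodReductionAt v)
    [Finite W.toAffine.Point] [Finite (W.selmerGroupPInfty p)] [Finite (AddCommGroup.primaryComponent (↥W.sha) p)]
    (𝓤inf : SelmerStructure (primaryGaloisModule W p))
    (hUp : 𝓤inf (Sum.inr (primePlace p)) = ⊤)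
    (hUur : ∀ v : HeightOneSpectrum (𝓞 ℚ), v ≠ primePlace p →
      𝓤inf (Sum.inr v) = unramifiedSubgroup (GaloisRep.toLocal v (primaryGaloisModule W p)) 1)
    (hUinl : ∀ w : InfinitePlace ℚ, 𝓤inf (Sum.inl w) = ⊤) (N : ℕ) :
    ∃ s K₀ : ℕ, ∀ k : ℕ, K₀ ≤ k →
      haveI := neZero_pow p s; haveI := neZero_pow p k
      haveI : Finite (geomTorsion W ((p ^ s * p ^ k : ℕ) : ℤ)) :=
        W.finite_torsionPoints_holds (AlgebraicClosure ℚ) (Int.natCast_ne_zero.mpr (NeZero.ne (p ^ s * p ^ k)))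
      haveI : Finite (geomTorsion W ((p ^ k : ℕ) : ℤ)) := Rank1Residual.X11b.AcSelmer.finite_geomTorsion_pow W p k
      ∀ (e : geomTorsion W ((p ^ s * p ^ k : ℕ) : ℤ) → geomTorsion W ((p ^ s * p ^ k : ℕ) : ℤ) → AlgebraicClosure ℚ)
        (hμ : ∀ S T, e S T ^ (p ^ s * p ^ k) = 1)
        (hadd₁ : ∀ S₁ S₂ T, e (S₁ + S₂) T = e S₁ T * e S₂ T)
        (hadd₂ : ∀ S T₁ T₂, e S (T₁ + T₂) = e S T₁ * e S T₂)
        (hgal : ∀ (σ : absoluteGaloisGroup ℚ) (S T : geomTorsion W ((p ^ s * p ^ k : ℕ) : ℤ)), σ • e S T = e (σ • S) (σ • T)),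
        (∀ P, e P P = 1) → (∀ P, (∀ Q, e Q P = 1) → P = 0) →
      ∀ (inv : LocalInvariants ℚ (p ^ s * p ^ k)), inv.IsPerfect → inv.SelmerComplement →
      Nat.card (W.selmerGroupPInfty p) *
          (∏ v ∈ T \ {primePlace p}, Nat.card (unramifiedSubgroup (GaloisRep.toLocal v (primaryGaloisModule W p)) 1)) *
          Nat.card ↥((integralH1 (tateRep W p) p ⊤).toAddSubgroup ⊓ (H1 (tateRep W p) ⊤)[((p ^ N : ℕ) : ℤ)]) ≤
        Nat.card ↥(𝓤inf.selmerGroup ⊓ selmerLocalKerPrimary W ((primePlace p).adicCompletion ℚ) p) *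
          (zsmulAddGroupHom ((p ^ k : ℕ) : ℤ) : W.toAffine.Point →+ W.toAffine.Point).range.index := by
  have hp : p.Prime := Fact.out
  -- a uniform exponent of `Ш[p^∞]` and g17's bound `e₁` of (hN) off `p`
  obtain ⟨s₀, hs₀⟩ := Rank1Residual.X11b.exists_pow_nsmul_eq_zero_of_finite_primaryComponent (A := ↥W.sha) p
  obtain ⟨e₁, he₁⟩ := exists_forall_hN W p {primePlace p} T
    (fun v hv => ⟨natCast_not_mem_of_ne_primePlace p (fun h => hv (h ▸ hpT)), hT v hv⟩)
  -- uniform exponents of the finite `p`-primary groups `H¹(ℚ_ℓ, E[p^∞])`, `ℓ ∈ T ∖ p`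
  have hB : ∀ Q : W.geomPrimaryTorsion p, ∃ j : ℕ, p ^ j • Q = 0 := fun Q =>
    (AddCommGroup.mem_primaryComponent.mp Q.2).imp fun j hj =>
      Subtype.ext (by rw [AddSubmonoidClass.coe_nsmul, hj, ZeroMemClass.coe_zero])
  have hK' : ∀ ℓ : ↥(T \ {primePlace p}), ∃ m : ℕ,
      ∀ u : galoisCohomology (GaloisRep.toLocal ℓ.1 (primaryGaloisModule W p)) 1, p ^ m • u = 0 := fun ℓ => by
    have hpℓ : ((p : ℕ) : 𝓞 ℚ) ∉ ℓ.1.asIdeal :=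
      natCast_not_mem_of_ne_primePlace p (fun h' => (Finset.mem_sdiff.1 ℓ.2).2 (Finset.mem_singleton.2 h'))
    haveI : CharZero (ℓ.1.adicCompletion ℚ) := charZero_adicCompletion _
    haveI : Finite (galoisCohomology (GaloisRep.toLocal ℓ.1 (primaryGaloisModule W p)) 1) :=
      finite_galoisCohomology_one_primary_toLocal W p ℓ.1 (localEulerPoincareCharacteristic_holds _) hpℓ
    obtain ⟨m, hm⟩ := Rank1Residual.X11b.exists_pow_nsmul_eq_zero_of_finite_primaryComponent
      (A := galoisCohomology (GaloisRep.toLocal ℓ.1 (primaryGaloisModule W p)) 1) p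
    refine ⟨m, fun u => ?_⟩
    obtain ⟨j, hj⟩ := exists_pow_nsmul_eq_zero_of_primary (GaloisRep.toLocal ℓ.1 (primaryGaloisModule W p)) hB u
    exact hm j u hj
  choose m hm using hK'
  refine ⟨s₀ + e₁, Finset.univ.sum m + W.torsionOrder + 1, fun k hk => ?_⟩
  haveI := neZero_pow p (s₀ + e₁); haveI := neZero_pow p k
  haveI : Finite (geomTorsion W ((p ^ (s₀ + e₁) * p ^ k : ℕ) : ℤ)) :=
    W.finite_torsionPoints_holds (AlgebraicClosure ℚ) (Int.natCast_ne_zero.mpr (NeZero.ne (p ^ (s₀ + e₁) * p ^ k)))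
  haveI : Finite (geomTorsion W ((p ^ k : ℕ) : ℤ)) := Rank1Residual.X11b.AcSelmer.finite_geomTorsion_pow W p k
  intro e hμ hadd₁ hadd₂ hgal halt hnondeg inv hperf hcompl
  obtain ⟨𝓖', hle, hgood, hT', hp'⟩ := exists_relaxedSelmerStructure W p (s₀ + e₁) k T hpT hT
  have htors : W.torsionOrder < p ^ k :=
    lt_of_lt_of_le (Nat.lt_pow_self hp.one_lt) (Nat.pow_le_pow_right hp.pos (by omega))
  refine natCard_selmerGroupPInfty_mul_prod_unramified_mul_torsion_le_index W p (s₀ + e₁) k T e hμ hadd₁ hadd₂ hgal inv hodd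
    (by omega) halt hnondeg hperf hcompl hpT hT htors 𝓤inf hUp hUur hUinl 𝓖' hle hgood hT' hp' ?_ ?_ ?_ N
  · -- `hs`: `p^{s₀+e₁}` kills the `p^s p^k`-torsion of `Ш`
    intro a ha h
    rw [natCast_zsmul, ← pow_add] at h
    have hQ : p ^ (s₀ + e₁ + k) • (⟨a, ha⟩ : ↥W.sha) = 0 := Subtype.ext h
    have hQ' : p ^ (s₀ + e₁) • (⟨a, ha⟩ : ↥W.sha) = 0 := by
      rw [pow_add, mul_comm, mul_smul, hs₀ (s₀ + e₁ + k) ⟨a, ha⟩ hQ, smul_zero]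
    exact congrArg Subtype.val hQ'
  · -- `hK`: `p^k` kills `H¹_ur(ℚ_ℓ, E[p^∞])`, `ℓ ∈ T ∖ p`
    intro v hv u _
    have hle' : m ⟨v, hv⟩ ≤ k :=
      (((Finset.single_le_sum (fun _ _ => Nat.zero_le _) (Finset.mem_univ _)).trans (Nat.le_add_right _ _)).trans
        (Nat.le_succ _)).trans hk
    rw [← Nat.sub_add_cancel hle', pow_add, mul_smul, hm ⟨v, hv⟩ u, smul_zero]
  · -- (hN) at every `ℓ ∈ T ∖ p` for `(k, s₀ + e₁)`
    intro v hv x hx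
    exact he₁ (s₀ + e₁) (Nat.le_add_left _ _) k v (fun h => (Finset.mem_sdiff.1 hv).2 h) x hx

end Turnkey

/-! ## §2 The sharp S-side -/

section SSide

variable (W : WeierstrassCurve ℚ) [W.IsElliptic] (p : ℕ) [Fact p.Prime] [ContinuousSMul ℤ_[p] (W.tateModule p)]
  (𝓤inf 𝓢inf : SelmerStructure (primaryGaloisModule W p))

/-- **THE SHARP S-SIDE: `#Sel_{p^∞} · ∏_{ℓ∈T∖{p}} #H¹_ur(ℚ_ℓ,E[p^∞]) · #(A ⊓ H¹(ℚ,T_pE)[p^N]) · [B_k(A) : B_k(A) ⊓ 𝓚_k^⊥] ≤ #Sel_str^{ur} · p^k · [E(ℚ) : p^k E(ℚ)]`**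
for all `k ≥ k₀` — brick (a) (part 39) times the SHARP Poitou–Tate companion (ii) (§1); hypotheses as part 46 with `W(ℚ)` finite.
[cite: Kato2004Asterisque, §14.8 (p. 238), Prop. 14.16 and its proof (pp. 244–245)] [cite: MilneADT2006, Ch. I, Cor. 2.3, Lemma 3.3, Thm. 4.10 (b)] -/
theorem exists_forall_sSide_sharp_le (hodd : p ≠ 2) (T : Finset (HeightOneSpectrum (𝓞 ℚ)))
    (hpT : primePlace p ∈ T) (hT : ∀ v : HeightOneSpectrum (𝓞 ℚ), v ∉ T → W.HasGoodReductionAt v)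
    [Finite W.toAffine.Point] [Finite (W.selmerGroupPInfty p)] [Finite (AddCommGroup.primaryComponent (↥W.sha) p)]
    (hUp : 𝓤inf (Sum.inr (primePlace p)) = ⊤)
    (hUur : ∀ v : HeightOneSpectrum (𝓞 ℚ), v ≠ primePlace p →
      𝓤inf (Sum.inr v) = unramifiedSubgroup (GaloisRep.toLocal v (primaryGaloisModule W p)) 1)
    (hUinl : ∀ w : InfinitePlace ℚ, 𝓤inf (Sum.inl w) = ⊤)
    (hSp : 𝓢inf (Sum.inr (primePlace p)) = ⊥)
    (hSur : ∀ v : HeightOneSpectrum (𝓞 ℚ), v ≠ primePlace p →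
      𝓢inf (Sum.inr v) = unramifiedSubgroup (GaloisRep.toLocal v (primaryGaloisModule W p)) 1)
    (hSinl : ∀ w : InfinitePlace ℚ, 𝓢inf (Sum.inl w) = ⊤) (N : ℕ) :
    ∃ j s k₀ : ℕ, ∀ k : ℕ, k₀ ≤ k →
      haveI := neZero_pow p j; haveI := neZero_pow p s; haveI := neZero_pow p k
      haveI : Finite (geomTorsion W ((p ^ k : ℕ) : ℤ)) := finite_geomTorsion_pow W p k
      haveI : Finite (geomTorsion W ((p ^ s * p ^ k : ℕ) : ℤ)) :=
        W.finite_torsionPoints_holds (AlgebraicClosure ℚ) (Int.natCast_ne_zero.mpr (NeZero.ne (p ^ s * p ^ k)))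
      ∀ (inv : LocalInvariants ℚ (p ^ j * p ^ k)), inv.SumLocalTermEqZero → inv.IsPerfect →
      ∀ (ε : geomTorsion W ((p ^ j * p ^ k : ℕ) : ℤ) → geomTorsion W ((p ^ j * p ^ k : ℕ) : ℤ) → AlgebraicClosure ℚ)
        (hμ : ∀ S T, ε S T ^ (p ^ j * p ^ k) = 1)
        (hadd₁ : ∀ S₁ S₂ T, ε (S₁ + S₂) T = ε S₁ T * ε S₂ T)
        (hadd₂ : ∀ S T₁ T₂, ε S (T₁ + T₂) = ε S T₁ * ε S T₂)
        (hgal : ∀ (σ : absoluteGaloisGroup ℚ) (S T : geomTorsion W ((p ^ j * p ^ k : ℕ) : ℤ)), σ • ε S T = ε (σ • S) (σ • T)),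
      ∀ (e : geomTorsion W ((p ^ s * p ^ k : ℕ) : ℤ) → geomTorsion W ((p ^ s * p ^ k : ℕ) : ℤ) → AlgebraicClosure ℚ)
        (hμ' : ∀ S T, e S T ^ (p ^ s * p ^ k) = 1)
        (hadd₁' : ∀ S₁ S₂ T, e (S₁ + S₂) T = e S₁ T * e S₂ T)
        (hadd₂' : ∀ S T₁ T₂, e S (T₁ + T₂) = e S T₁ * e S T₂)
        (hgal' : ∀ (σ : absoluteGaloisGroup ℚ) (S T : geomTorsion W ((p ^ s * p ^ k : ℕ) : ℤ)), σ • e S T = e (σ • S) (σ • T)),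
        (∀ P, e P P = 1) → (∀ P, (∀ Q, e Q P = 1) → P = 0) →
      ∀ (inv' : LocalInvariants ℚ (p ^ s * p ^ k)), inv'.IsPerfect → inv'.SelmerComplement →
      Nat.card (W.selmerGroupPInfty p) *
            (∏ v ∈ T \ {primePlace p}, Nat.card (unramifiedSubgroup (GaloisRep.toLocal v (primaryGaloisModule W p)) 1)) *
            Nat.card ↥((integralH1 (tateRep W p) p ⊤).toAddSubgroup ⊓ (H1 (tateRep W p) ⊤)[((p ^ N : ℕ) : ℤ)]) *
            ((((integralH1 (tateRep W p) p ⊤).toAddSubgroup.map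
                  (((galoisCohomology.map (W.torsionInclusion (intPow_dvd_natCast_pow p k)) 1).comp
                      (ofTopSubgroup (W.torsionGaloisModule ((p : ℤ) ^ k)).toTopRep 1).hom.toLinearMap.toAddMonoidHom).comp
                    (reduceH1Pk W p k ⊤))).map
                  (galoisCohomology.map (DiscreteGaloisModule.pairingDualIntertwining
                    (ρ₁ := W.torsionGaloisModule ((p ^ k : ℕ) : ℤ)) (ρ₂ := W.torsionGaloisModule ((p ^ k : ℕ) : ℤ))
                    (B := descendHom W (p ^ j) (p ^ k) ε hμ hadd₁ hadd₂)
                    (descendHom_smul W (p ^ j) (p ^ k) ε hμ hadd₁ hadd₂ hgal)) 1)).map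
                (galoisCohomology.localization ((W.torsionGaloisModule ((p ^ k : ℕ) : ℤ)).tateDual (p ^ j * p ^ k))
                  (Sum.inr (primePlace p)) 1) ⊓
              annRight (localTatePairingZMod (W.torsionGaloisModule ((p ^ k : ℕ) : ℤ)) (p ^ j * p ^ k)
                (Sum.inr (primePlace p)) (inv (Sum.inr (primePlace p))))
                (W.kummerSelmerStructure ((p ^ k : ℕ) : ℤ) (Sum.inr (primePlace p)))).relIndex
              ((((integralH1 (tateRep W p) p ⊤).toAddSubgroup.map
                  (((galoisCohomology.map (W.torsionInclusion (intPow_dvd_natCast_pow p k)) 1).comp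
                      (ofTopSubgroup (W.torsionGaloisModule ((p : ℤ) ^ k)).toTopRep 1).hom.toLinearMap.toAddMonoidHom).comp
                    (reduceH1Pk W p k ⊤))).map
                  (galoisCohomology.map (DiscreteGaloisModule.pairingDualIntertwining
                    (ρ₁ := W.torsionGaloisModule ((p ^ k : ℕ) : ℤ)) (ρ₂ := W.torsionGaloisModule ((p ^ k : ℕ) : ℤ))
                    (B := descendHom W (p ^ j) (p ^ k) ε hμ hadd₁ hadd₂)
                    (descendHom_smul W (p ^ j) (p ^ k) ε hμ hadd₁ hadd₂ hgal)) 1)).map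
                (galoisCohomology.localization ((W.torsionGaloisModule ((p ^ k : ℕ) : ℤ)).tateDual (p ^ j * p ^ k))
                  (Sum.inr (primePlace p)) 1)) ≤
        Nat.card 𝓢inf.selmerGroup * p ^ k *
          (zsmulAddGroupHom ((p ^ k : ℕ) : ℤ) : W.toAffine.Point →+ W.toAffine.Point).range.index := by
  obtain ⟨j, k₁, hA⟩ := exists_forall_natCard_kato_mul_relIndex_le W p 𝓤inf 𝓢inf hodd T hpT hT hUp hUur hUinl hSp hSur hSinl
  obtain ⟨s, k₂, hB⟩ := exists_forall_natCard_selmerGroupPInfty_mul_prod_unramified_mul_torsion_le W p T hodd hpT hT 𝓤inf hUp hUur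
    hUinl N
  refine ⟨j, s, max k₁ k₂, fun k hk => ?_⟩
  intro inv hsum hperf ε hμ hadd₁ hadd₂ hgal e hμ' hadd₁' hadd₂' hgal' halt hnondeg inv' hperf' hcompl'
  have h1 := hA k ((le_max_left _ _).trans hk) inv hsum hperf ε hμ hadd₁ hadd₂ hgal
  have h2 := hB k ((le_max_right _ _).trans hk) e hμ' hadd₁' hadd₂' hgal' halt hnondeg inv' hperf' hcompl'
  exact (Nat.mul_le_mul_right _ h2).trans
    ((Nat.mul_right_comm _ _ _).le.trans (Nat.mul_le_mul_right _ h1))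

end SSide

/-! ## §3 The sharp ledger at the zeta line -/

section Arith

/-- The assembly: `S·t·rA ≤ R` and `rY·i ≤ rA·t` give `S·rY·i ≤ R` (the torsion factor `t` cancels). [folklore] -/
theorem mul_junction_sharp_le {S t rA R rY i : ℕ} (h1 : S * t * rA ≤ R) (hj : rY * i ≤ rA * t) : S * rY * i ≤ R :=
  calc S * rY * i = S * (rY * i) := mul_assoc _ _ _
    _ ≤ S * (rA * t) := Nat.mul_le_mul_left _ hj
    _ = S * t * rA := by ring
    _ ≤ R := h1

end Arith

section ASide

variable (W : WeierstrassCurve ℚ) [W.IsElliptic] (p : ℕ) [Fact p.Prime] [ContinuousSMul ℤ_[p] (W.tateModule p)]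
  (𝓤inf 𝓢inf : SelmerStructure (primaryGaloisModule W p))

/-- **THE SHARP A⊕S LEDGER OF CRUX M AT THE ZETA LINE: `#Sel_{p^∞} · ∏_{ℓ∈T∖{p}} #H¹_ur(ℚ_ℓ,E[p^∞]) · [B_k(ℤ_p y₀) : B_k(ℤ_p y₀) ⊓ 𝓚_k^⊥] · [A : ℤ_p y₀]
≤ #Sel_str^{ur} · p^k · [E(ℚ) : p^k E(ℚ)]`** for all `k ≥ k₀` — §2 × the junction (part 47 at `f_k`, `Y = ℤ_p y₀`, `n = p^N`); the junction's factor
`#(A ⊓ H¹(ℚ,T_pE)[p^N])` CANCELS against the same factor of the sharp S-side.  Hypotheses: those of part 49 with `W(ℚ)` finite; `y₀ ∈ A` with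
`p^N A ⊆ ℤ_p y₀`; the zeta-line saturation `hY` at the level `k` (brick (b), displayed).  Rank-`0` reading: part 49's with ONE `t₀` less, i.e. Kato's
Prop. 14.16 (2) count at the member with `2·ord_p #W(ℚ)_tors` after (b′), (c2′).
[cite: Kato2004Asterisque, §14.8 (p. 238), Prop. 14.16 and its proof (pp. 244–245), Lemma 14.18 (pp. 247–248), Thm. 14.5 (2) (p. 236)]
[cite: MilneADT2006, Ch. I, Cor. 2.3, Lemma 3.3, Thm. 4.10 (b)] [cite: GreenbergLNM1716, appendix to §4] -/
theorem exists_forall_aSide_sharp_le (hodd : p ≠ 2) (T : Finset (HeightOneSpectrum (𝓞 ℚ)))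
    (hpT : primePlace p ∈ T) (hT : ∀ v : HeightOneSpectrum (𝓞 ℚ), v ∉ T → W.HasGoodReductionAt v)
    [Finite W.toAffine.Point] [Finite (W.selmerGroupPInfty p)] [Finite (AddCommGroup.primaryComponent (↥W.sha) p)]
    (hUp : 𝓤inf (Sum.inr (primePlace p)) = ⊤)
    (hUur : ∀ v : HeightOneSpectrum (𝓞 ℚ), v ≠ primePlace p →
      𝓤inf (Sum.inr v) = unramifiedSubgroup (GaloisRep.toLocal v (primaryGaloisModule W p)) 1)
    (hUinl : ∀ w : InfinitePlace ℚ, 𝓤inf (Sum.inl w) = ⊤)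
    (hSp : 𝓢inf (Sum.inr (primePlace p)) = ⊥)
    (hSur : ∀ v : HeightOneSpectrum (𝓞 ℚ), v ≠ primePlace p →
      𝓢inf (Sum.inr v) = unramifiedSubgroup (GaloisRep.toLocal v (primaryGaloisModule W p)) 1)
    (hSinl : ∀ w : InfinitePlace ℚ, 𝓢inf (Sum.inl w) = ⊤)
    (y₀ : H1 (tateRep W p) ⊤) (hy₀ : y₀ ∈ integralH1 (tateRep W p) p ⊤) (N : ℕ)
    (hN : ∀ a ∈ integralH1 (tateRep W p) p ⊤, ((p ^ N : ℕ) : ℤ) • a ∈ (ℤ_[p] ∙ y₀).toAddSubgroup) :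
    ∃ j s k₀ : ℕ, ∀ k : ℕ, k₀ ≤ k →
      haveI := neZero_pow p j; haveI := neZero_pow p s; haveI := neZero_pow p k
      haveI : Finite (geomTorsion W ((p ^ k : ℕ) : ℤ)) := finite_geomTorsion_pow W p k
      haveI : Finite (geomTorsion W ((p ^ s * p ^ k : ℕ) : ℤ)) :=
        W.finite_torsionPoints_holds (AlgebraicClosure ℚ) (Int.natCast_ne_zero.mpr (NeZero.ne (p ^ s * p ^ k)))
      ∀ (inv : LocalInvariants ℚ (p ^ j * p ^ k)), inv.SumLocalTermEqZero → inv.IsPerfect →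
      ∀ (ε : geomTorsion W ((p ^ j * p ^ k : ℕ) : ℤ) → geomTorsion W ((p ^ j * p ^ k : ℕ) : ℤ) → AlgebraicClosure ℚ)
        (hμ : ∀ S T, ε S T ^ (p ^ j * p ^ k) = 1)
        (hadd₁ : ∀ S₁ S₂ T, ε (S₁ + S₂) T = ε S₁ T * ε S₂ T)
        (hadd₂ : ∀ S T₁ T₂, ε S (T₁ + T₂) = ε S T₁ * ε S T₂)
        (hgal : ∀ (σ : absoluteGaloisGroup ℚ) (S T : geomTorsion W ((p ^ j * p ^ k : ℕ) : ℤ)), σ • ε S T = ε (σ • S) (σ • T)),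
      (∀ y ∈ (ℤ_[p] ∙ y₀).toAddSubgroup,
        ((galoisCohomology.localization ((W.torsionGaloisModule ((p ^ k : ℕ) : ℤ)).tateDual (p ^ j * p ^ k))
              (Sum.inr (primePlace p)) 1).comp
            ((galoisCohomology.map (DiscreteGaloisModule.pairingDualIntertwining
                (ρ₁ := W.torsionGaloisModule ((p ^ k : ℕ) : ℤ)) (ρ₂ := W.torsionGaloisModule ((p ^ k : ℕ) : ℤ))
                (B := descendHom W (p ^ j) (p ^ k) ε hμ hadd₁ hadd₂)
                (descendHom_smul W (p ^ j) (p ^ k) ε hμ hadd₁ hadd₂ hgal)) 1).comp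
              (((galoisCohomology.map (W.torsionInclusion (intPow_dvd_natCast_pow p k)) 1).comp
                  (ofTopSubgroup (W.torsionGaloisModule ((p : ℤ) ^ k)).toTopRep 1).hom.toLinearMap.toAddMonoidHom).comp
                (reduceH1Pk W p k ⊤)))) y ∈
          annRight (localTatePairingZMod (W.torsionGaloisModule ((p ^ k : ℕ) : ℤ)) (p ^ j * p ^ k)
            (Sum.inr (primePlace p)) (inv (Sum.inr (primePlace p))))
            (W.kummerSelmerStructure ((p ^ k : ℕ) : ℤ) (Sum.inr (primePlace p))) →
        ∃ y' ∈ (ℤ_[p] ∙ y₀).toAddSubgroup, ((p ^ N : ℕ) : ℤ) • y' = y) →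
      ∀ (e : geomTorsion W ((p ^ s * p ^ k : ℕ) : ℤ) → geomTorsion W ((p ^ s * p ^ k : ℕ) : ℤ) → AlgebraicClosure ℚ)
        (hμ' : ∀ S T, e S T ^ (p ^ s * p ^ k) = 1)
        (hadd₁' : ∀ S₁ S₂ T, e (S₁ + S₂) T = e S₁ T * e S₂ T)
        (hadd₂' : ∀ S T₁ T₂, e S (T₁ + T₂) = e S T₁ * e S T₂)
        (hgal' : ∀ (σ : absoluteGaloisGroup ℚ) (S T : geomTorsion W ((p ^ s * p ^ k : ℕ) : ℤ)), σ • e S T = e (σ • S) (σ • T)),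
        (∀ P, e P P = 1) → (∀ P, (∀ Q, e Q P = 1) → P = 0) →
      ∀ (inv' : LocalInvariants ℚ (p ^ s * p ^ k)), inv'.IsPerfect → inv'.SelmerComplement →
      Nat.card (W.selmerGroupPInfty p) *
            (∏ v ∈ T \ {primePlace p}, Nat.card (unramifiedSubgroup (GaloisRep.toLocal v (primaryGaloisModule W p)) 1)) *
            ((((ℤ_[p] ∙ y₀).toAddSubgroup.map
                  (((galoisCohomology.map (W.torsionInclusion (intPow_dvd_natCast_pow p k)) 1).comp
                      (ofTopSubgroup (W.torsionGaloisModule ((p : ℤ) ^ k)).toTopRep 1).hom.toLinearMap.toAddMonoidHom).comp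
                    (reduceH1Pk W p k ⊤))).map
                  (galoisCohomology.map (DiscreteGaloisModule.pairingDualIntertwining
                    (ρ₁ := W.torsionGaloisModule ((p ^ k : ℕ) : ℤ)) (ρ₂ := W.torsionGaloisModule ((p ^ k : ℕ) : ℤ))
                    (B := descendHom W (p ^ j) (p ^ k) ε hμ hadd₁ hadd₂)
                    (descendHom_smul W (p ^ j) (p ^ k) ε hμ hadd₁ hadd₂ hgal)) 1)).map
                (galoisCohomology.localization ((W.torsionGaloisModule ((p ^ k : ℕ) : ℤ)).tateDual (p ^ j * p ^ k))
                  (Sum.inr (primePlace p)) 1) ⊓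
              annRight (localTatePairingZMod (W.torsionGaloisModule ((p ^ k : ℕ) : ℤ)) (p ^ j * p ^ k)
                (Sum.inr (primePlace p)) (inv (Sum.inr (primePlace p))))
                (W.kummerSelmerStructure ((p ^ k : ℕ) : ℤ) (Sum.inr (primePlace p)))).relIndex
              ((((ℤ_[p] ∙ y₀).toAddSubgroup.map
                  (((galoisCohomology.map (W.torsionInclusion (intPow_dvd_natCast_pow p k)) 1).comp
                      (ofTopSubgroup (W.torsionGaloisModule ((p : ℤ) ^ k)).toTopRep 1).hom.toLinearMap.toAddMonoidHom).comp
                    (reduceH1Pk W p k ⊤))).map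
                  (galoisCohomology.map (DiscreteGaloisModule.pairingDualIntertwining
                    (ρ₁ := W.torsionGaloisModule ((p ^ k : ℕ) : ℤ)) (ρ₂ := W.torsionGaloisModule ((p ^ k : ℕ) : ℤ))
                    (B := descendHom W (p ^ j) (p ^ k) ε hμ hadd₁ hadd₂)
                    (descendHom_smul W (p ^ j) (p ^ k) ε hμ hadd₁ hadd₂ hgal)) 1)).map
                (galoisCohomology.localization ((W.torsionGaloisModule ((p ^ k : ℕ) : ℤ)).tateDual (p ^ j * p ^ k))
                  (Sum.inr (primePlace p)) 1)) *
            ((ℤ_[p] ∙ y₀).toAddSubgroup.relIndex (integralH1 (tateRep W p) p ⊤).toAddSubgroup) ≤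
        Nat.card 𝓢inf.selmerGroup * p ^ k *
          (zsmulAddGroupHom ((p ^ k : ℕ) : ℤ) : W.toAffine.Point →+ W.toAffine.Point).range.index := by
  obtain ⟨j, s, k₀, hS⟩ := exists_forall_sSide_sharp_le W p 𝓤inf 𝓢inf hodd T hpT hT hUp hUur hUinl hSp hSur hSinl N
  refine ⟨j, s, k₀, fun k hk => ?_⟩
  intro inv hsum hperf ε hμ hadd₁ hadd₂ hgal hY e hμ' hadd₁' hadd₂' hgal' halt hnondeg inv' hperf' hcompl'
  have h1 := hS k hk inv hsum hperf ε hμ hadd₁ hadd₂ hgal e hμ' hadd₁' hadd₂' hgal' halt hnondeg inv' hperf' hcompl'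
  -- the junction (part 47) at `f_k = loc_p ∘ (desc^♭)_* ∘ (ι′_* ∘ red_{p^k})`, `Y = ℤ_p y₀ ≤ A`, `n = p^N`
  have hYA : (ℤ_[p] ∙ y₀).toAddSubgroup ≤ (integralH1 (tateRep W p) p ⊤).toAddSubgroup := by
    intro x hx
    rw [Submodule.mem_toAddSubgroup, Submodule.mem_span_singleton] at hx
    obtain ⟨c, rfl⟩ := hx
    exact (integralH1 (tateRep W p) p ⊤).smul_mem c hy₀
  haveI := finite_inf_torsionBy W (integralH1 (tateRep W p) p ⊤).toAddSubgroup N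
  have hj := relIndex_map_mul_relIndex_le _ _ _ _ hYA ((p ^ N : ℕ) : ℤ) hN hY
  simp only [AddSubgroup.map_map] at h1 ⊢
  -- the torsion factor of the junction cancels against the sharp S-side: `S₀·t·r(A) ≤ R`, `r(Y)·[A:Y] ≤ r(A)·t` ⟹ `S₀·r(Y)·[A:Y] ≤ R`
  exact mul_junction_sharp_le h1 hj

end ASide

end Summit.BirchSwinnertonDyer.BirchSwinnertonDyer.Theorems.KatoFiniteLevelCount

end
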